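import Literature.NumberTheory.Automorphic.AdelicTensorStripping
import HarnessLib

/-!
# Irreducibility of the finite Schrödinger module `𝒮((𝔸_K^∞)^ι)`

Topic `NumberTheory/Automorphic`; namespace `Literature.NumberTheory.Automorphic`. Origin: `pub-hodgecm`
MODEL-CONSTRUCTION sub-cell, node W2-⊗ / (⊗S)-𝔸 (iii), finite-implementer seam (F1). KERNEL MATHEMATICS
ONLY: every declaration below is proved; no `def … : Prop` record, no cited hypothesis.

THE STATEMENT (`eq_top_of_invariant`). Let `W` be a `ℂ`-linear subspace of the Schwartz–Bruhat space
`𝒮((𝔸_K^∞)^ι) = FinSB K ι` of the finite-adele points of `K^ι` which is stable under all FINITE HEISENBERG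
OPERATORS: the translations `f ↦ f(k + ·)` (`finTranslateSB k`) and the modulations `f ↦ ψ_f(Σ_i y_i b_i) f`
(`finModulateSB y`), `k, y ∈ (𝔸_K^∞)^ι`. Then `W = 0` or `W = 𝒮((𝔸_K^∞)^ι)`: the smooth Schrödinger module
of the finite-adelic Heisenberg group is IRREDUCIBLE ([MoeglinVignerasWaldspurger1987, Chap. 2 I.3–I.4] for
a local field; [Weil1964, Chap. I n° 11–12] for the operators). Consequences (§4): the finite FIXED-VECTOR
LEMMA (`eq_smul_indicatorSB_of_fixed`), SCHUR'S LEMMA in the form "an endomorphism commuting with all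
finite Heisenberg operators is a scalar" (`eq_smul_id_of_comm`), and the injectivity / surjectivity of
non-zero maps with invariant kernel / image (`injective_of_invariant`, `surjective_of_invariant`) — the
input of the finite implementers of the adelic metaplectic group (`AdelicMetaplecticFiniteImplementer`).

THE PROOF is elementary and Fourier-free GIVEN the sharp bi-annihilator `(L^♮)^♮ = L` of
`AdelicTensorStripping` (`dualBox_dualBox_eq`, `mem_iff_forall_dualBox`). Take `0 ≠ f ∈ W`; translating,
`f(0) ≠ 0`; `f` has a level, a compact open subgroup `L` with `f = Σ_{q ∈ s} f(q) 𝟙_{q + L}` (finite coset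
decomposition, `exists_eq_sum_smul_finTranslateSB_indicatorSB`). The translates `𝟙_{c + L}` are joint
EIGENVECTORS of the modulations by `y ∈ L^♮` with eigencharacters `χ_c(y) = ψ_f(Σ_i y_i c_i)`
(`finModulateSB_finTranslateSB_neg_indicatorSB`), and DISTINCT cosets have DISTINCT eigencharacters — this is
exactly `(L^♮)^♮ = L` (`exists_mem_dualBox_addChar_ne`). An abstract elimination lemma
(`smul_mem_of_forall_sum_smul_mem`: if `Σ_a c_a χ_a(y) e_a ∈ W` for all `y` and the characters `χ_a` are
pairwise distinct, then each `c_a e_a ∈ W`; induction on the number of terms, killing one character at a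
time with `χ_a(y₀) - χ_b(y₀) ≠ 0`) isolates `f(0) 𝟙_L ∈ W`, so `𝟙_L ∈ W` (`indicatorSB_mem_of_mem`). Applied at
a common level of `f` and of an arbitrary `u`, all translates of `𝟙_L` lie in `W`, hence so does `u`.

Contents: §1 the elimination lemma; §2 eigencharacters of coset indicators and their separation; §3 isolation
and irreducibility; §4 fixed vectors, Schur, injectivity / surjectivity.

## References

* [MoeglinVignerasWaldspurger1987] C. Mœglin, M.-F. Vignéras, J.-L. Waldspurger, *Correspondances de Howe sur
  un corps p-adique*, LNM 1291 (1987), Chap. 2, I.2 (Théorème de Stone–von Neumann), I.3 (irréductibilité de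
  `ρ` sur `S_A`: "Soient `S'` un sous-espace non nul de `S_A` invariant par `H` … on obtient `f_{w,L} ∈ S'`.
  Ces fonctions engendrant `S_A`, on a `S' = S_A`"), I.4 Exemple (1) (the model on `𝒮(Y)`).
* [Weil1964] A. Weil, *Sur certains groupes d'opérateurs unitaires*, Acta Math. 111 (1964), Chap. I n° 4
  p. 149 (the operators `U(w)`), n° 11–12 pp. 158–160 (`𝒮(X)` is stable; standard functions).
-/

noncomputable section

open NumberField IsDedekindDomain
open scoped Classical

namespace Literature.NumberTheory.Automorphic

/-! ## 1. Elimination of pairwise distinct characters -/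

section Elimination

variable {V : Type*} [AddCommGroup V] [Module ℂ V]

/-- **Elimination lemma.** Let `W` be a subspace, `e_a` vectors, `c_a` scalars and `χ_a : A → ℂ`
multiplicative characters of an additive monoid (`χ_a(y + y') = χ_a(y) χ_a(y')`, `χ_a(0) = 1`) which are
PAIRWISE DISTINCT on the finite index set `s`. If `Σ_{a ∈ s} c_a χ_a(y) e_a ∈ W` for every `y`, then
`c_a e_a ∈ W` for every `a ∈ s` (induction on `s`: the combination at `y₀ + y` minus `χ_b(y₀)` times the
combination at `y` has coefficients `c_a (χ_a(y₀) - χ_b(y₀))`, killing the term `b`; a separating `y₀`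
recovers `c_a e_a`, and the term `b` is the remainder at `y = 0`). [folklore] -/
theorem smul_mem_of_forall_sum_smul_mem (W : Submodule ℂ V) {α A : Type*} [AddMonoid A]
    (χ : α → A → ℂ) (hmul : ∀ a y y', χ a (y + y') = χ a y * χ a y') (hone : ∀ a, χ a 0 = 1)
    (e : α → V) (s : Finset α) :
    ∀ c : α → ℂ, (∀ a ∈ s, ∀ b ∈ s, a ≠ b → ∃ y, χ a y ≠ χ b y) →
      (∀ y, ∑ a ∈ s, (c a * χ a y) • e a ∈ W) → ∀ a ∈ s, c a • e a ∈ W := by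
  induction s using Finset.induction_on with
  | empty =>
    intro c _ _ a ha
    exact absurd ha (Finset.notMem_empty a)
  | @insert b s hb ih =>
    intro c hsep hmem
    -- the terms indexed by `s`, with coefficients twisted by `χ a y₀ - χ b y₀`
    have hstep : ∀ y₀, ∀ a ∈ s, (c a * (χ a y₀ - χ b y₀)) • e a ∈ W := by
      intro y₀
      refine ih (fun a => c a * (χ a y₀ - χ b y₀))
        (fun a ha a' ha' => hsep a (Finset.mem_insert_of_mem ha) a' (Finset.mem_insert_of_mem ha')) ?_
      intro y
      show ∑ a ∈ s, (c a * (χ a y₀ - χ b y₀) * χ a y) • e a ∈ W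
      have hcoef : ∀ a, (c a * χ a (y₀ + y)) • e a - χ b y₀ • ((c a * χ a y) • e a) =
          (c a * (χ a y₀ - χ b y₀) * χ a y) • e a := fun a => by
        rw [hmul, smul_smul, ← sub_smul]
        congr 1
        ring
      have key : ∑ a ∈ insert b s, (c a * χ a (y₀ + y)) • e a -
          χ b y₀ • ∑ a ∈ insert b s, (c a * χ a y) • e a =
            ∑ a ∈ s, (c a * (χ a y₀ - χ b y₀) * χ a y) • e a := by
        rw [Finset.smul_sum, ← Finset.sum_sub_distrib, Finset.sum_congr rfl fun a _ => hcoef a,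
          Finset.sum_insert hb, sub_self, mul_zero, zero_mul, zero_smul, zero_add]
      rw [← key]
      exact W.sub_mem (hmem (y₀ + y)) (W.smul_mem _ (hmem y))
    -- the terms indexed by `s`
    have hrest : ∀ a ∈ s, c a • e a ∈ W := by
      intro a ha
      have hne : a ≠ b := fun h => hb (h ▸ ha)
      obtain ⟨y₀, hy₀⟩ := hsep a (Finset.mem_insert_of_mem ha) b (Finset.mem_insert_self b s) hne
      have hd : χ a y₀ - χ b y₀ ≠ 0 := sub_ne_zero.2 hy₀
      have h := W.smul_mem (χ a y₀ - χ b y₀)⁻¹ (hstep y₀ a ha)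
      rwa [smul_smul, mul_left_comm, inv_mul_cancel₀ hd, mul_one] at h
    intro a ha
    rcases Finset.mem_insert.1 ha with rfl | ha
    · -- the new term is the remainder at `y = 0`
      have h0 := hmem 0
      simp_rw [hone, mul_one] at h0
      rw [Finset.sum_insert hb] at h0
      have h := W.sub_mem h0 (W.sum_mem fun a' ha' => hrest a' ha')
      rwa [add_sub_cancel_right] at h
    · exact hrest a ha

end Elimination

/-! ## 2. Eigencharacters of the coset indicators and their separation -/

section Characters

variable {K : Type} [Field K] [NumberField K] {ι : Type} [Fintype ι]

omit [Fintype ι] in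
/-- Finite translations compose: `(f(k' + ·))(k + ·) = f(k' + k + ·)`. [folklore] -/
theorem finTranslateSB_finTranslateSB (k k' : ι → FiniteAdeleRing (𝓞 K) K) (f : FinSB K ι) :
    finTranslateSB K ι k (finTranslateSB K ι k' f) = finTranslateSB K ι (k' + k) f :=
  Subtype.ext (funext fun b => by simp only [coe_finTranslateSB_apply, add_assoc])

/-- **The coset indicators are joint eigenvectors of the modulations by `L^♮`**: for `y ∈ L^♮`,
`ψ_f(Σ_i y_i ·_i) 𝟙_{c + L} = ψ_f(Σ_i y_i c_i) 𝟙_{c + L}` (`ψ_f(Σ_i y_i (c + l)_i) = ψ_f(Σ_i y_i c_i)` for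
`l ∈ L`). [cite: Weil1964, Chap. I n° 11 p. 158] -/
theorem finModulateSB_finTranslateSB_neg_indicatorSB (L : AddSubgroup (ι → FiniteAdeleRing (𝓞 K) K))
    (hLo : IsOpen (L : Set (ι → FiniteAdeleRing (𝓞 K) K)))
    (hLc : IsCompact (L : Set (ι → FiniteAdeleRing (𝓞 K) K))) {y : ι → FiniteAdeleRing (𝓞 K) K}
    (hy : y ∈ dualBox K ι L) (c : ι → FiniteAdeleRing (𝓞 K) K) :
    finModulateSB K ι y (finTranslateSB K ι (-c) (indicatorSB K ι L hLo hLc)) =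
      (finiteAdeleAddChar K (∑ i, y i * c i) : ℂ) •
        finTranslateSB K ι (-c) (indicatorSB K ι L hLo hLc) := by
  apply Subtype.ext
  rw [coe_finModulateSB_apply, Submodule.coe_smul, coe_finTranslateSB_apply, coe_indicatorSB]
  funext b
  simp only [Pi.smul_apply, smul_eq_mul]
  by_cases hb : -c + b ∈ L
  · have hsum : ∑ i, y i * b i = ∑ i, y i * c i + ∑ i, y i * (-c + b) i := by
      rw [← Finset.sum_add_distrib]
      exact Finset.sum_congr rfl fun i _ => by rw [Pi.add_apply, Pi.neg_apply]; ring
    rw [hsum, AddChar.map_add_eq_mul, Circle.coe_mul, hy _ hb]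
    simp only [Circle.coe_one, mul_one]
  · rw [Set.indicator_of_notMem (show -c + b ∉ (L : Set _) from hb), mul_zero, mul_zero]

/-- **Distinct cosets have distinct eigencharacters**: if `-c + c' ∉ L` then some `y ∈ L^♮` has
`ψ_f(Σ_i y_i c_i) ≠ ψ_f(Σ_i y_i c'_i)` — this is the bi-annihilator `(L^♮)^♮ = L`
(`mem_iff_forall_dualBox`). [folklore] -/
theorem exists_mem_dualBox_addChar_ne (L : AddSubgroup (ι → FiniteAdeleRing (𝓞 K) K))
    (hLo : IsOpen (L : Set (ι → FiniteAdeleRing (𝓞 K) K)))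
    (hLc : IsCompact (L : Set (ι → FiniteAdeleRing (𝓞 K) K))) {c c' : ι → FiniteAdeleRing (𝓞 K) K}
    (h : -c + c' ∉ L) :
    ∃ y ∈ dualBox K ι L, (finiteAdeleAddChar K (∑ i, y i * c i) : ℂ) ≠
      (finiteAdeleAddChar K (∑ i, y i * c' i) : ℂ) := by
  by_contra hall
  push Not at hall
  refine h ((mem_iff_forall_dualBox L hLo hLc _).2 fun y hy => ?_)
  have hsum : ∑ i, y i * (-c + c') i = -(∑ i, y i * c i) + ∑ i, y i * c' i := by
    rw [← Finset.sum_neg_distrib, ← Finset.sum_add_distrib]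
    exact Finset.sum_congr rfl fun i _ => by rw [Pi.add_apply, Pi.neg_apply]; ring
  rw [hsum, AddChar.map_add_eq_mul, AddChar.map_neg_eq_inv, inv_mul_eq_one]
  exact Circle.ext (hall y hy)

end Characters

/-! ## 3. Isolation of `𝟙_L` and irreducibility -/

section Irreducible

variable {K : Type} [Field K] [NumberField K] {ι : Type} [Fintype ι]

/-- **Isolation.** Let `W ≤ 𝒮((𝔸_K^∞)^ι)` be stable under the modulations by `L^♮` (`L` compact open) and let
`f ∈ W` be `L`-invariant with `f(0) ≠ 0`. Then `𝟙_L ∈ W`: write `f = Σ_{q ∈ s} f(q) 𝟙_{q + L}`; modulating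
by `y ∈ L^♮` multiplies the `q`-th term by `ψ_f(Σ_i y_i q_i)`, these characters of `L^♮` are pairwise
distinct, so the elimination lemma puts every term in `W`, in particular `f(0) 𝟙_L`.
[cite: MoeglinVignerasWaldspurger1987, Chap. 2 I.3] -/
theorem indicatorSB_mem_of_mem (L : AddSubgroup (ι → FiniteAdeleRing (𝓞 K) K))
    (hLo : IsOpen (L : Set (ι → FiniteAdeleRing (𝓞 K) K)))
    (hLc : IsCompact (L : Set (ι → FiniteAdeleRing (𝓞 K) K))) (W : Submodule ℂ (FinSB K ι))
    (hmod : ∀ y ∈ dualBox K ι L, ∀ f ∈ W, finModulateSB K ι y f ∈ W) {f : FinSB K ι} (hf : f ∈ W)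
    (hinv : ∀ x, ∀ l ∈ L, (f : (ι → FiniteAdeleRing (𝓞 K) K) → ℂ) (x + l) =
      (f : (ι → FiniteAdeleRing (𝓞 K) K) → ℂ) x)
    (hf0 : (f : (ι → FiniteAdeleRing (𝓞 K) K) → ℂ) 0 ≠ 0) :
    indicatorSB K ι L hLo hLc ∈ W := by
  obtain ⟨s, hs⟩ := exists_eq_sum_smul_finTranslateSB_indicatorSB L hLo hLc f hinv
  -- every term of the coset decomposition lies in `W`
  have hterm : ∀ q ∈ s, (f : (ι → FiniteAdeleRing (𝓞 K) K) → ℂ) q.out •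
      finTranslateSB K ι (-(q.out : ι → FiniteAdeleRing (𝓞 K) K)) (indicatorSB K ι L hLo hLc) ∈ W := by
    refine smul_mem_of_forall_sum_smul_mem W
      (fun (q : (ι → FiniteAdeleRing (𝓞 K) K) ⧸ L) (y : ↥(dualBox K ι L)) =>
        (finiteAdeleAddChar K (∑ i, (y : ι → FiniteAdeleRing (𝓞 K) K) i *
          (q.out : ι → FiniteAdeleRing (𝓞 K) K) i) : ℂ))
      ?_ ?_ (fun q => finTranslateSB K ι (-(q.out : ι → FiniteAdeleRing (𝓞 K) K)) (indicatorSB K ι L hLo hLc))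
      s (fun q => (f : (ι → FiniteAdeleRing (𝓞 K) K) → ℂ) q.out) ?_ ?_
    · intro q y y'
      simp only [AddSubgroup.coe_add, Pi.add_apply, add_mul, Finset.sum_add_distrib, AddChar.map_add_eq_mul,
        Circle.coe_mul]
    · intro q
      simp only [AddSubgroup.coe_zero, Pi.zero_apply, zero_mul, Finset.sum_const_zero,
        AddChar.map_zero_eq_one, Circle.coe_one]
    · intro q _ q' _ hne
      have h : -(q.out : ι → FiniteAdeleRing (𝓞 K) K) + q'.out ∉ L := fun hmem => hne <| by
        rw [← QuotientAddGroup.out_eq' q, ← QuotientAddGroup.out_eq' q']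
        exact QuotientAddGroup.eq.2 hmem
      obtain ⟨y, hy, hne'⟩ := exists_mem_dualBox_addChar_ne L hLo hLc h
      exact ⟨⟨y, hy⟩, hne'⟩
    · intro y
      have hcalc : finModulateSB K ι (y : ι → FiniteAdeleRing (𝓞 K) K) f =
          ∑ q ∈ s, ((f : (ι → FiniteAdeleRing (𝓞 K) K) → ℂ) q.out *
            (finiteAdeleAddChar K (∑ i, (y : ι → FiniteAdeleRing (𝓞 K) K) i *
              (q.out : ι → FiniteAdeleRing (𝓞 K) K) i) : ℂ)) •
            finTranslateSB K ι (-(q.out : ι → FiniteAdeleRing (𝓞 K) K)) (indicatorSB K ι L hLo hLc) := by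
        conv_lhs => rw [hs]
        rw [map_sum]
        refine Finset.sum_congr rfl fun q _ => ?_
        rw [map_smul, finModulateSB_finTranslateSB_neg_indicatorSB L hLo hLc y.2, smul_smul]
      have h := hmod y y.2 f hf
      rw [hcalc] at h
      exact h
  -- evaluating the decomposition at `0`: the coset of `0` occurs, with coefficient `f(0)`
  have heval : (f : (ι → FiniteAdeleRing (𝓞 K) K) → ℂ) 0 =
      if (QuotientAddGroup.mk (0 : ι → FiniteAdeleRing (𝓞 K) K) : _ ⧸ L) ∈ s then
        (f : (ι → FiniteAdeleRing (𝓞 K) K) → ℂ)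
          (QuotientAddGroup.mk (0 : ι → FiniteAdeleRing (𝓞 K) K) : _ ⧸ L).out else 0 := by
    conv_lhs => rw [hs]
    rw [AddSubmonoidClass.coe_finsetSum, Finset.sum_apply]
    simp_rw [Submodule.coe_smul, Pi.smul_apply, smul_eq_mul, coe_finTranslateSB_neg_indicatorSB]
    exact sum_mul_indicator_out_vadd L s _ 0
  have hmem0 : (QuotientAddGroup.mk (0 : ι → FiniteAdeleRing (𝓞 K) K) : _ ⧸ L) ∈ s := by
    by_contra h0
    rw [if_neg h0] at heval
    exact hf0 heval
  rw [if_pos hmem0] at heval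
  have hcoef : (f : (ι → FiniteAdeleRing (𝓞 K) K) → ℂ)
      (QuotientAddGroup.mk (0 : ι → FiniteAdeleRing (𝓞 K) K) : _ ⧸ L).out ≠ 0 := heval ▸ hf0
  have hneg : -((QuotientAddGroup.mk (0 : ι → FiniteAdeleRing (𝓞 K) K) : _ ⧸ L).out :
      ι → FiniteAdeleRing (𝓞 K) K) ∈ L := by
    have h := QuotientAddGroup.eq.1
      (QuotientAddGroup.out_eq' (QuotientAddGroup.mk (0 : ι → FiniteAdeleRing (𝓞 K) K) : _ ⧸ L))
    rwa [add_zero] at h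
  have h := hterm _ hmem0
  rw [finTranslateSB_indicatorSB_of_mem L hLo hLc hneg] at h
  have h' := W.smul_mem ((f : (ι → FiniteAdeleRing (𝓞 K) K) → ℂ)
    (QuotientAddGroup.mk (0 : ι → FiniteAdeleRing (𝓞 K) K) : _ ⧸ L).out)⁻¹ h
  rwa [smul_smul, inv_mul_cancel₀ hcoef, one_smul] at h'

/-- **Irreducibility of the finite Schrödinger module.** A subspace of `𝒮((𝔸_K^∞)^ι)` stable under all
finite translations `f ↦ f(k + ·)` and all modulations `f ↦ ψ_f(Σ_i y_i b_i) f` (`k, y ∈ (𝔸_K^∞)^ι`) and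
non-zero is everything: the smooth Schrödinger representation of the finite-adelic Heisenberg group on
`𝒮((𝔸_K^∞)^ι)` is irreducible. [cite: MoeglinVignerasWaldspurger1987, Chap. 2 I.3] -/
theorem eq_top_of_invariant (W : Submodule ℂ (FinSB K ι))
    (htr : ∀ k : ι → FiniteAdeleRing (𝓞 K) K, ∀ f ∈ W, finTranslateSB K ι k f ∈ W)
    (hmod : ∀ y : ι → FiniteAdeleRing (𝓞 K) K, ∀ f ∈ W, finModulateSB K ι y f ∈ W) (hW : W ≠ ⊥) :
    W = ⊤ := by
  -- a vector of `W` not vanishing at `0`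
  obtain ⟨f, hfW, hf0⟩ := (Submodule.ne_bot_iff W).1 hW
  have hx : ∃ x₀, (f : (ι → FiniteAdeleRing (𝓞 K) K) → ℂ) x₀ ≠ 0 := by
    by_contra h
    push Not at h
    exact hf0 (Subtype.ext (funext fun x => by rw [h x]; rfl))
  obtain ⟨x₀, hx₀⟩ := hx
  have hgW : finTranslateSB K ι x₀ f ∈ W := htr x₀ f hfW
  have hg0 : ((finTranslateSB K ι x₀ f : FinSB K ι) : (ι → FiniteAdeleRing (𝓞 K) K) → ℂ) 0 ≠ 0 := by
    show (f : (ι → FiniteAdeleRing (𝓞 K) K) → ℂ) (x₀ + 0) ≠ 0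
    rwa [add_zero]
  -- a common level of this vector and of an arbitrary `u`
  obtain ⟨𝔫, h𝔫, hlev⟩ := exists_level_of_mem_schwartzBruhat K (finTranslateSB K ι x₀ f).2
  refine eq_top_iff.2 fun u _ => ?_
  obtain ⟨𝔪, h𝔪, hlevu⟩ := exists_level_of_mem_schwartzBruhat K u.2
  have hne : 𝔫 * 𝔪 ≠ 0 := mul_ne_zero h𝔫 h𝔪
  have hL𝔫 : piLevelIdeal K ι (𝔫 * 𝔪) ≤ piLevelIdeal K ι 𝔫 := piLevelIdeal_mono K hne Ideal.mul_le_right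
  have hL𝔪 : piLevelIdeal K ι (𝔫 * 𝔪) ≤ piLevelIdeal K ι 𝔪 := piLevelIdeal_mono K hne Ideal.mul_le_left
  -- `𝟙_L ∈ W`
  have hind : indicatorSB K ι (piLevelIdeal K ι (𝔫 * 𝔪)) (isOpen_piLevelIdeal K (𝔫 * 𝔪))
      (isCompact_piLevelIdeal K ι (𝔫 * 𝔪)) ∈ W :=
    indicatorSB_mem_of_mem _ _ _ W (fun y _ f hf => hmod y f hf) hgW
      (fun x l hl => hlev x l (hL𝔫 hl)) hg0
  -- `u` is a finite combination of translates of `𝟙_L`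
  obtain ⟨s, hs⟩ := exists_eq_sum_smul_finTranslateSB_indicatorSB (piLevelIdeal K ι (𝔫 * 𝔪))
    (isOpen_piLevelIdeal K (𝔫 * 𝔪)) (isCompact_piLevelIdeal K ι (𝔫 * 𝔪)) u
    (fun x l hl => hlevu x l (hL𝔪 hl))
  rw [hs]
  exact W.sum_mem fun q _ => W.smul_mem _ (htr _ _ hind)

/-- The dichotomy form: an invariant subspace is `⊥` or `⊤`. [cite: MoeglinVignerasWaldspurger1987, Chap. 2 I.3] -/
theorem eq_bot_or_eq_top_of_invariant (W : Submodule ℂ (FinSB K ι))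
    (htr : ∀ k : ι → FiniteAdeleRing (𝓞 K) K, ∀ f ∈ W, finTranslateSB K ι k f ∈ W)
    (hmod : ∀ y : ι → FiniteAdeleRing (𝓞 K) K, ∀ f ∈ W, finModulateSB K ι y f ∈ W) :
    W = ⊥ ∨ W = ⊤ :=
  or_iff_not_imp_left.2 (eq_top_of_invariant W htr hmod)

end Irreducible

/-! ## 4. Fixed vectors, Schur's lemma, injectivity and surjectivity -/

section Schur

variable {K : Type} [Field K] [NumberField K] {ι : Type} [Fintype ι]

/-- **Finite fixed-vector lemma**: a Schwartz–Bruhat function fixed by the translations by a compact open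
subgroup `L` and by the modulations by `L^♮` is `f(0) 𝟙_L` (off `L` some `y ∈ L^♮` has `ψ_f(Σ_i y_i b_i) ≠ 1`,
again by `(L^♮)^♮ = L`). [cite: MoeglinVignerasWaldspurger1987, Chap. 2 I.3] -/
theorem eq_smul_indicatorSB_of_fixed (L : AddSubgroup (ι → FiniteAdeleRing (𝓞 K) K))
    (hLo : IsOpen (L : Set (ι → FiniteAdeleRing (𝓞 K) K)))
    (hLc : IsCompact (L : Set (ι → FiniteAdeleRing (𝓞 K) K))) {f : FinSB K ι}
    (htr : ∀ l ∈ L, finTranslateSB K ι l f = f) (hmod : ∀ y ∈ dualBox K ι L, finModulateSB K ι y f = f) :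
    f = (f : (ι → FiniteAdeleRing (𝓞 K) K) → ℂ) 0 • indicatorSB K ι L hLo hLc := by
  apply Subtype.ext
  rw [Submodule.coe_smul, coe_indicatorSB]
  funext b
  rw [Pi.smul_apply, smul_eq_mul]
  by_cases hb : b ∈ L
  · rw [Set.indicator_of_mem (show b ∈ (L : Set _) from hb), mul_one]
    have h := congrArg (fun g : FinSB K ι => (g : (ι → FiniteAdeleRing (𝓞 K) K) → ℂ) 0) (htr b hb)
    simp only [coe_finTranslateSB_apply, add_zero] at h
    exact h
  · rw [Set.indicator_of_notMem (show b ∉ (L : Set _) from hb), mul_zero]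
    obtain ⟨y, hy, hne⟩ : ∃ y ∈ dualBox K ι L, finiteAdeleAddChar K (∑ i, y i * b i) ≠ 1 := by
      by_contra h
      push Not at h
      exact hb ((mem_iff_forall_dualBox L hLo hLc b).2 h)
    have h := congrArg (fun g : FinSB K ι => (g : (ι → FiniteAdeleRing (𝓞 K) K) → ℂ) b) (hmod y hy)
    simp only [coe_finModulateSB_apply] at h
    have hne' : (finiteAdeleAddChar K (∑ i, y i * b i) : ℂ) ≠ 1 := fun h1 => hne (Circle.coe_eq_one.1 h1)
    have h2 : ((finiteAdeleAddChar K (∑ i, y i * b i) : ℂ) - 1) *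
        (f : (ι → FiniteAdeleRing (𝓞 K) K) → ℂ) b = 0 := by
      rw [sub_mul, one_mul, h, sub_self]
    rcases mul_eq_zero.1 h2 with h0 | h0
    · exact absurd (sub_eq_zero.1 h0) hne'
    · exact h0

/-- **Schur's lemma for the finite Schrödinger module**: a linear endomorphism of `𝒮((𝔸_K^∞)^ι)`
commuting with all finite translations and modulations is a scalar (it fixes the line `ℂ 𝟙_{𝒪̂^ι}` of
vectors fixed by `𝒪̂^ι × (𝒪̂^ι)^♮`, and the kernel of `C - c` is invariant and non-zero).
[cite: MoeglinVignerasWaldspurger1987, Chap. 2 I.2] -/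
theorem eq_smul_id_of_comm (C : FinSB K ι →ₗ[ℂ] FinSB K ι)
    (htr : ∀ (k : ι → FiniteAdeleRing (𝓞 K) K) (f : FinSB K ι),
      C (finTranslateSB K ι k f) = finTranslateSB K ι k (C f))
    (hmod : ∀ (y : ι → FiniteAdeleRing (𝓞 K) K) (f : FinSB K ι),
      C (finModulateSB K ι y f) = finModulateSB K ι y (C f)) :
    ∃ c : ℂ, C = c • LinearMap.id := by
  have hLo := isOpen_piLevelIdeal K (ι := ι) ⊤
  have hLc := isCompact_piLevelIdeal K ι ⊤
  set e : FinSB K ι := indicatorSB K ι (piLevelIdeal K ι ⊤) hLo hLc with he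
  -- `C e` is a fixed vector, hence a multiple of `e`
  have hfix : C e = ((C e : FinSB K ι) : (ι → FiniteAdeleRing (𝓞 K) K) → ℂ) 0 • e := by
    refine eq_smul_indicatorSB_of_fixed _ hLo hLc (fun l hl => ?_) (fun y hy => ?_)
    · rw [← htr, he, finTranslateSB_indicatorSB_of_mem _ hLo hLc hl]
    · rw [← hmod, he, finModulateSB_indicatorSB_of_mem _ hLo hLc hy]
  refine ⟨((C e : FinSB K ι) : (ι → FiniteAdeleRing (𝓞 K) K) → ℂ) 0, ?_⟩
  set c : ℂ := ((C e : FinSB K ι) : (ι → FiniteAdeleRing (𝓞 K) K) → ℂ) 0 with hc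
  -- the kernel of `C - c` is invariant and contains `e ≠ 0`
  have hker : LinearMap.ker (C - c • LinearMap.id) = ⊤ := by
    refine (eq_bot_or_eq_top_of_invariant (LinearMap.ker (C - c • LinearMap.id)) ?_ ?_).resolve_left ?_
    · intro k f hf
      rw [LinearMap.mem_ker, LinearMap.sub_apply, LinearMap.smul_apply, LinearMap.id_apply] at hf ⊢
      rw [htr, ← map_smul, ← map_sub, hf, map_zero]
    · intro y f hf
      rw [LinearMap.mem_ker, LinearMap.sub_apply, LinearMap.smul_apply, LinearMap.id_apply] at hf ⊢
      rw [hmod, ← map_smul, ← map_sub, hf, map_zero]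
    · intro hbot
      have he0 : e ∈ LinearMap.ker (C - c • LinearMap.id) := by
        rw [LinearMap.mem_ker, LinearMap.sub_apply, LinearMap.smul_apply, LinearMap.id_apply, hfix, sub_self]
      rw [hbot, Submodule.mem_bot] at he0
      have h1 : ((e : FinSB K ι) : (ι → FiniteAdeleRing (𝓞 K) K) → ℂ) 0 = 1 := by
        rw [he, coe_indicatorSB, Set.indicator_of_mem (show (0 : ι → FiniteAdeleRing (𝓞 K) K) ∈
          (piLevelIdeal K ι ⊤ : Set _) from (piLevelIdeal K ι ⊤).zero_mem)]
      rw [he0] at h1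
      exact zero_ne_one h1
  refine LinearMap.ext fun f => ?_
  have hf : f ∈ LinearMap.ker (C - c • LinearMap.id) := hker ▸ Submodule.mem_top
  rw [LinearMap.mem_ker, LinearMap.sub_apply, sub_eq_zero] at hf
  exact hf

/-- **A non-zero linear map out of `𝒮((𝔸_K^∞)^ι)` whose kernel is stable under the finite translations and
modulations is injective** (the kernel is an invariant subspace `≠ ⊤`). [cite: MoeglinVignerasWaldspurger1987, Chap. 2 I.3] -/
theorem injective_of_invariant {V : Type*} [AddCommGroup V] [Module ℂ V] (N : FinSB K ι →ₗ[ℂ] V)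
    (htr : ∀ (k : ι → FiniteAdeleRing (𝓞 K) K) (f : FinSB K ι), N f = 0 → N (finTranslateSB K ι k f) = 0)
    (hmod : ∀ (y : ι → FiniteAdeleRing (𝓞 K) K) (f : FinSB K ι), N f = 0 → N (finModulateSB K ι y f) = 0)
    (hN : N ≠ 0) : Function.Injective N := by
  rw [← LinearMap.ker_eq_bot]
  refine (eq_bot_or_eq_top_of_invariant (LinearMap.ker N) (fun k f hf => ?_) (fun y f hf => ?_)).resolve_right
    fun htop => hN (LinearMap.ker_eq_top.1 htop)
  · exact LinearMap.mem_ker.2 (htr k f (LinearMap.mem_ker.1 hf))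
  · exact LinearMap.mem_ker.2 (hmod y f (LinearMap.mem_ker.1 hf))

/-- **A non-zero linear map into `𝒮((𝔸_K^∞)^ι)` whose image is stable under the finite translations and
modulations is surjective** (the image is an invariant subspace `≠ ⊥`). [cite: MoeglinVignerasWaldspurger1987, Chap. 2 I.3] -/
theorem surjective_of_invariant {V : Type*} [AddCommGroup V] [Module ℂ V] (N : V →ₗ[ℂ] FinSB K ι)
    (htr : ∀ (k : ι → FiniteAdeleRing (𝓞 K) K) (v : V), ∃ v', N v' = finTranslateSB K ι k (N v))
    (hmod : ∀ (y : ι → FiniteAdeleRing (𝓞 K) K) (v : V), ∃ v', N v' = finModulateSB K ι y (N v))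
    (hN : N ≠ 0) : Function.Surjective N := by
  rw [← LinearMap.range_eq_top]
  refine (eq_bot_or_eq_top_of_invariant (LinearMap.range N) ?_ ?_).resolve_left
    fun hbot => hN (LinearMap.range_eq_bot.1 hbot)
  · rintro k _ ⟨v, rfl⟩
    obtain ⟨v', hv'⟩ := htr k v
    exact ⟨v', hv'⟩
  · rintro y _ ⟨v, rfl⟩
    obtain ⟨v', hv'⟩ := hmod y v
    exact ⟨v', hv'⟩

end Schur

end Literature.NumberTheory.Automorphic
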